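import Summits.Ventures.QEC.Census.CertBZList
import Summits.Ventures.QEC.Census.BB.S8_126_w6_k12_01061B01.Q126Defs
import HarnessLib

set_option Elab.async false
set_option maxRecDepth 200000

/-!
# `[[252,12,16]]` one-level cover certificate of `S8_126_w6_k12_01061B01` — the tower QUOTIENT `Q126` (u = 0 case): decided ROW FACTS (`Q126Rows`)

On the objects of `Q126Defs`: the rows of the systematic matrix of the `u = 0` Brouwer–Zimmermann block are words below `2^126`
and there are 69 of them (the hypotheses `hG` / `hc` of the `CertBZPlaneTree` leaves used by the adaptive split sub-trees `Q126Tree*` and by `Q126Low`).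
Theorems only; `decide +kernel`; KERNEL; axioms standard. Generated by gen/gen_q.py (qec-search-1 g5 generic generators; sub-tree split added by
qec-search-3 g11 for the 400-line rule, pattern of `L1Rows` / `L1Tree*`).
-/

namespace Summit.Ventures.QEC.Census.S8_126_w6_k12_01061B01

open Matrix Summit.Ventures.QEC.Census Literature.InformationTheory.QuantumCodes

/-- Rows of matrix 1 are words below `2^126`. -/
theorem u0G0_lt : ∀ g ∈ giRows S8_126_w6_k12_01061B01.q126Gb u0m0, g < 2 ^ 126 := by
  have h : ((giRows q126Gb u0m0).all fun g => decide (g < 2 ^ 126)) = true := by decide +kernel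
  simpa [List.all_eq_true] using h

/-- Matrix 1 has 69 rows. -/
theorem u0G0_len : (giRows S8_126_w6_k12_01061B01.q126Gb u0m0).length = 69 := by decide +kernel


end Summit.Ventures.QEC.Census.S8_126_w6_k12_01061B01
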